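import Literature.AlgebraicGeometry.Resolution.LinearSectionsCharts
import Literature.AlgebraicGeometry.Resolution.BertiniIterated
import HarnessLib

/-!
# Bertini and avoidance for linear forms on a closed subscheme of `ℙ^N_k`

Topic: `Literature/AlgebraicGeometry/Resolution`. The geometric form of `BertiniIterated` for a
closed subscheme `ι : X ↪ ℙ^N_k` over an algebraically closed field (Hartshorne II 8.18 and
Rem. 8.18.1; de Jong 1996, 2.11 and the Bertini paragraph of the proof of 4.11), in the
vocabulary of `LinearSectionsCharts` (`LinSec.hyp`, `LinSec.cutSet`, `LinSec.cutIdeal`):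

* `LinSec.isGeneric_regular_cut` — **Bertini, iterated, on `X`**: given linear forms
  `a₀, …, a_{j-1}`, for a generic further form `b`, at every closed point `x` of
  `X ∩ V(a₀,…,a_{j-1}) ∩ V(b)` at which `𝒪_{X,x}/(a₀,…,a_{j-1})` is regular, the local ring
  `𝒪_{X,x}/(a₀,…,a_{j-1},b)` is regular;
* `LinSec.isGeneric_notMem_hyp` — **a generic hyperplane misses a given point** (closed or not,
  e.g. the generic point of an irreducible closed subset, which then is not contained in it).

Everything is proved; no named facts.

## References

* R. Hartshorne, *Algebraic Geometry* (1977), II Thm. 8.18, Rem. 8.18.1. [Hartshorne1977]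
* A. J. de Jong, *Smoothness, semi-stability and alterations*, Publ. Math. IHÉS 83 (1996), 2.11
  and proof of 4.11 (p. 68). [DeJong1996]
-/

noncomputable section

open CategoryTheory AlgebraicGeometry TopologicalSpace Opposite HomogeneousLocalization
open Literature.AlgebraicGeometry.Morphisms.ProjCech (grading PP)
open Literature.AlgebraicGeometry.Motives
open Literature.AlgebraicGeometry.Motives.ProjFrac

attribute [local instance] MvPolynomial.gradedAlgebra
  Literature.AlgebraicGeometry.Motives.ProjBaseChange.algebraBase

namespace Literature.AlgebraicGeometry.Resolution

universe u

namespace LinSec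

open BertiniAffine

variable {k : Type u} [Field k] {N : ℕ} {X : Scheme.{u}} (ι : X ⟶ PP k N)

attribute [local instance] chartAlgebra

/-! ## The hypotheses of `BertiniIterated` for the chart rings -/

/-- The section of a linear form is the linear combination `linComb` of the coordinates (the
`BertiniAffine` spelling). [folklore] -/
theorem linComb_coordSec (h : Fin (N + 1)) (b : Fin (N + 1) → k) :
    linComb (coordSec ι h) b = linSec ι h b := by
  rw [linComb, linSec_eq_sum]

/-- **The chart coordinates separate tangent vectors**: `t ↦ Σ t_l (x_l/x_h) mod 𝔪²` is onto for
every maximal `𝔪` of `Γ(chart h, 𝒪_X)` (`ι` a closed immersion, `k` algebraically closed).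
[folklore] -/
theorem surjective_linCombQuotSq_coordSec [IsAlgClosed k] [IsClosedImmersion ι] (h : Fin (N + 1))
    (𝔪 : Ideal Γ(X, chart ι h)) (h𝔪 : 𝔪.IsMaximal) :
    Function.Surjective (linCombQuotSq (k := k) (coordSec ι h) 𝔪) := by
  haveI := finiteType_chart ι h
  exact surjective_linCombQuotSq_of_adjoin_eq_top (coordSec ι h) (adjoin_coordSec_eq_top ι h)
    (coordSec_self ι h) 𝔪

/-- Extending the family by one form adds one generator to `secIdeal`. [folklore] -/
theorem secIdeal_snoc [IsAffineHom ι] (h : Fin (N + 1)) {j : ℕ} (a : Fin j → Fin (N + 1) → k)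
    (b : Fin (N + 1) → k) :
    secIdeal ι h (Fin.snoc a b : Fin (j + 1) → Fin (N + 1) → k) =
      secIdeal ι h a ⊔ Ideal.span {linSec ι h b} := by
  rw [secIdeal, secIdeal, ← Ideal.span_union]
  congr 1
  ext g
  simp only [Set.mem_range, Set.mem_union, Set.mem_singleton_iff]
  constructor
  · rintro ⟨i, rfl⟩
    refine Fin.lastCases ?_ (fun i => ?_) i
    · exact Or.inr (by simp [Fin.snoc_last])
    · exact Or.inl ⟨i, by simp [Fin.snoc_castSucc]⟩
  · rintro (⟨i, rfl⟩ | rfl)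
    · exact ⟨Fin.castSucc i, by simp [Fin.snoc_castSucc]⟩
    · exact ⟨Fin.last j, by simp [Fin.snoc_last]⟩

/-- On `V(a₀,…,a_{j-1})` the ideal `secIdeal` lies in the prime of the point. [folklore] -/
theorem secIdeal_le_ptIdeal [IsAffineHom ι] (h : Fin (N + 1)) {x : X} (hx : x ∈ chart ι h)
    {j : ℕ} {a : Fin j → Fin (N + 1) → k} (hxa : x ∈ cutSet ι a) :
    secIdeal ι h a ≤ ptIdeal ι h x hx := by
  refine Ideal.span_le.mpr ?_
  rintro g ⟨i, rfl⟩
  exact (mem_hyp_iff_linSec_mem_ptIdeal ι h hx (a i)).mp (Set.mem_iInter.mp hxa i)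

/-! ## Bertini, iterated, on `X` -/

/-- **Bertini on one chart.** [cite: Hartshorne1977, II Thm. 8.18 and Rem. 8.18.1] -/
theorem isGeneric_regular_cut_chart [IsAlgClosed k] [IsClosedImmersion ι] (h : Fin (N + 1))
    {j : ℕ} (a : Fin j → Fin (N + 1) → k) :
    IsGeneric fun b : Fin (N + 1) → k => ∀ (x : X) (hx : x ∈ chart ι h), IsClosed ({x} : Set X) →
      x ∈ cutSet ι a → x ∈ hyp ι b →
        IsRegularLocalRing (X.presheaf.stalk x ⧸ cutIdeal ι x a) →
          IsRegularLocalRing (X.presheaf.stalk x ⧸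
            cutIdeal ι x (Fin.snoc a b : Fin (j + 1) → Fin (N + 1) → k)) := by
  haveI := finiteType_chart ι h
  refine (isGeneric_isRegularLocalRing_quotient_sup (coordSec ι h)
    (surjective_linCombQuotSq_coordSec ι h) (secIdeal ι h a)).mono fun b hb x hx hxc hxa hxb hreg => ?_
  haveI := ptIdeal_isMaximal ι h hx hxc
  have H := hb (ptIdeal ι h x hx) (secIdeal_le_ptIdeal ι h hx hxa)
    ((isRegularLocalRing_quotient_cutIdeal_iff ι h hx a).mp hreg)
    (by rw [linComb_coordSec]; exact (mem_hyp_iff_linSec_mem_ptIdeal ι h hx b).mp hxb)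
  rw [linComb_coordSec, ← secIdeal_snoc] at H
  exact (isRegularLocalRing_quotient_cutIdeal_iff ι h hx _).mpr H

/-- **Bertini's theorem, iterated, for a closed subscheme `X ⊆ ℙ^N_k` over an algebraically
closed field**: given linear forms `a₀, …, a_{j-1}`, for a generic linear form `b`, at every
closed point `x ∈ X ∩ V(a₀, …, a_{j-1}, b)` at which `𝒪_{X,x}/(a₀, …, a_{j-1})` is a regular
local ring, so is `𝒪_{X,x}/(a₀, …, a_{j-1}, b)`. (For `j = 0`: a general hyperplane section of
`X` is regular at the regular closed points of `X` lying on it.)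
[cite: Hartshorne1977, II Thm. 8.18 and Rem. 8.18.1] -/
theorem isGeneric_regular_cut [IsAlgClosed k] [IsClosedImmersion ι] {j : ℕ}
    (a : Fin j → Fin (N + 1) → k) :
    IsGeneric fun b : Fin (N + 1) → k => ∀ x : X, IsClosed ({x} : Set X) →
      x ∈ cutSet ι a → x ∈ hyp ι b →
        IsRegularLocalRing (X.presheaf.stalk x ⧸ cutIdeal ι x a) →
          IsRegularLocalRing (X.presheaf.stalk x ⧸
            cutIdeal ι x (Fin.snoc a b : Fin (j + 1) → Fin (N + 1) → k)) := by
  refine (IsGeneric.forall_fintype fun h => isGeneric_regular_cut_chart ι h a).mono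
    fun b hb x hxc hxa hxb hreg => ?_
  obtain ⟨h, hx⟩ := exists_mem_chart ι x
  exact hb h x hx hxc hxa hxb hreg

/-! ## Avoidance -/

/-- **A generic hyperplane misses a given point** of `X` (any point: for the generic point of an
irreducible closed subset `C` this says that the generic hyperplane section does not contain
`C`). [folklore] -/
theorem isGeneric_notMem_hyp [IsAffineHom ι] (x : X) :
    IsGeneric fun b : Fin (N + 1) → k => x ∉ hyp ι b := by
  classical
  obtain ⟨h, hx⟩ := exists_mem_chart ι x
  have hne : ptIdeal ι h x hx ≠ ⊤ := (inferInstance : (ptIdeal ι h x hx).IsPrime).ne_top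
  have h1 : ∃ l, coordSec ι h l ∉ ptIdeal ι h x hx :=
    ⟨h, by rw [coordSec_self]; exact (Ideal.ne_top_iff_one _).mp hne⟩
  refine (isGeneric_linComb_notMem_ideal (coordSec ι h) (ptIdeal ι h x hx) h1).mono
    fun b hb hxb => hb ?_
  rw [linComb_coordSec]
  exact (mem_hyp_iff_linSec_mem_ptIdeal ι h hx b).mp hxb

/-- A generic hyperplane misses each of finitely many given points. [folklore] -/
theorem isGeneric_forall_notMem_hyp [IsAffineHom ι] {S : Set X} (hS : S.Finite) :
    IsGeneric fun b : Fin (N + 1) → k => ∀ x ∈ S, x ∉ hyp ι b :=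
  IsGeneric.forall_mem_finite hS fun x _ => isGeneric_notMem_hyp ι x

end LinSec

end Literature.AlgebraicGeometry.Resolution

end
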